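import Summits.BirchSwinnertonDyer.Rank1Residual.X10.CoreTheoremAOddPrime
import Literature.NumberTheory.EllipticCurves.Rank1Residual.MuLambdaCarriers
import HarnessLib
import HarnessLib.Audit

/-!
# The Euler loss, GRADED: «no `μ`-divisor of `X₀(E/ℚ_∞)` deeper than the Euler loss» (ES-C4), «at most
# one `μ`-divisor» (B2), «no `μ`-divisor of `X(E/ℚ_∞)` deeper than `μ(L_p)`» (ES-C5) — the cell's
# Euler-system-lens gen-2 nodes, filed as OPEN obligation nodes (`@[conjecture] def`); nothing asserted

HONEST FRAMING (cell `bsd-f3-mu`, D-0131 (3) FRONTIER TIER, HOME `run/shared/lean/pub/bsd-f3-mu/`).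
TYPER's filing of the `-es` lens's generation-2 statements (MEMO-es v3 §14–§19, `HOME/es/Sketch4.lean`
sha16 9b1adb0b5913fde4, rc 0, 0 sorry; BC7 3/3 CLEAN `es/bc7_verdicts3.txt`): a pure CONJECTURE LEAF.
THE LENS QUESTION AS A NUMBER (MEMO-es §14): per elementary `μ`-divisor `Λ/p^{μ_i}` of `X₀(E/ℚ_∞)`
the one-prime Euler machine loses exactly the Euler loss `δ := μ(𝐇¹/Λ𝐳₁)` and nothing more — DEPTH
`max μ_i ≤ δ` (ES-C4; `n = 0` is the kernel core theorem `X10.coreTheoremAOddPrime_holds`, `n ≥ 1` the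
planner's graded-core blueprint over `Λ/(p^{n+1}, ω²)` modulo four labelled stubs, MEMO-es §15); what it
cannot see is the WIDTH (number of `μ`-divisors): B2 («at most one») is OPEN and STRICTLY WEAKER than
Conjecture A on X9 (`SmallImageMu.ConjAOnClassX9`); ES-C4 ∧ B2 ⟹ S-es-3
(`SmallImageMu.FineMuLeEulerLossOnClassX9`, edges file `GradedEulerLossEdges.lean`, pure logic), and
S-es-3 with the F1 identity `μ(X₀) = k + δ + c` gives the crux `KatoDivisibilityOnClassX9`; so
**crux stmt-20547 = ES-C4 (depth, ported-theorem candidate) ∧ B2 (width, open)** (planner's reading).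
ES-C5 is the same statement in the summit's currency (`X`, `μ(L_p)`).

## Provenance (cell record)

* MEMO-es.md §14–§19 + STATUS 16:10:35Z (planner `-es` g2): **ES-C4 `FineExponentLeEulerLossOnClassX9`**,
  **B2 `FineMuConcentratedOnClassX9`**, **ES-C5 `MuExponentLeAnalyticMuOnClassX9`** (per-pair body
  inlined here per ref1: «the per-pair def lacks an ordinarity guard — file only the X9 version»);
  falsifier vs `k6fin_unitcoeff_cert.tsv` dde28b2c4045f536: 0 open-regime rows, 790/790 decided TRUE at
  `n = 0` by kernel + F1, 0 refuting; crux-line card `es/idea-graded-core-theorem-a-x9.md` = evidence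
  #12/#13 on stmt-BirchSwinnertonDyer-20547.
* REF1-AUDIT.md §3.3 (refuter `-ref1` g2, 16:20Z; EsProbe4.lean rc 0, BC7 CLEAN): **ES-C4 SURVIVES**
  (graded; `n = 0` PROVED in-file from `coreTheoremAOddPrime_holds` + F1; `n ≥ 1` OPEN blueprint;
  `augIdealP = pΛ` so `μ(𝔭ⁿ•⊤) = Σ max(μ_i − n, 0)` ✓); **B2 SURVIVES/OPEN** faithful (⟺ ≤ 1 `μ`-divisor;
  ⊊ Conj A∣X9; bridge ES-C4 ∧ B2 ⟹ S-es-3 pure logic ✓); **ES-C5 SURVIVES/OPEN** graded (`n = 0` = the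
  tree's X9 `μ`-transfer).
* REF2-LITMAP.md §3 (refuter `-ref2` g3, 16:15Z): ES-C4 `n ≥ 1` = OPEN-not-in-print at `𝔭 = (p)` (=
  KOLY Remark 5.7.1′(2) «version over `Λ/p^k` … plausible and NOT claimed»; Kato Thm 13.4 proves it at
  `𝔭 ∌ p` image-free; Mazur–Rubin 5.3.10 / p. 67 `𝔓_N = (U^N + p)` with `τ`); B2 OPEN ⊊ Conj A; ES-C5
  OPEN, between Kato 17.4 (2) and 17.4 (3).
* Why (planner): the graded decomposition isolates exactly what a one-prime Euler argument can and
  cannot prove at small image: depth yes (port KOLY Thm 5.7.1 to the Gorenstein ring `Λ/(p^{n+1}, ω²)`),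
  width no («two independent `μ`-divisors are invisible to any one-prime argument», KOLY 5.9.B).

References: [Kato2004Asterisque] Thm. 12.5/12.6 (p. 222), Thm. 13.4 (p. 226), §13.8, Thm. 17.4, §17.13;
[MazurRubin2004] Thm. 5.3.10 and p. 67; [GreenbergVatsal2000] Prop. 3.7; [CoatesSujatha2005] Conj. A;
HOME MEMO-es.md §14–§19, es/Sketch4.lean, REF1-AUDIT.md §3.3, REF2-LITMAP.md §3, CANDIDATES.md §1.
-/

-- the summit and its single problem are both named `BirchSwinnertonDyer` (registry layout D-0017)
set_option linter.dupNamespace false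

noncomputable section

open scoped Classical MatrixGroups ModularForm

open CongruenceSubgroup WeierstrassCurve Field Literature.NumberTheory.EllipticCurves
  Literature.NumberTheory.EllipticCurves.ModularForms
  Literature.NumberTheory.EllipticCurves.Kato2004
  Literature.NumberTheory.EllipticCurves.Kato2004.EulerSystemValues
  Summit.BirchSwinnertonDyer.BirchSwinnertonDyer.Rank1Residual

namespace Summit.BirchSwinnertonDyer.Rank1Residual.SmallImageMu

/-- **ES-C4 — the graded core theorem: per-divisor exponent ≤ Euler loss (OPEN for `n ≥ 1`; `n = 0`
is the kernel core theorem; nothing asserted).**  At every X9 pair `(E, p)` and every `n : ℕ`: if some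
genuine `Λ`-adic Euler-system class `s` of Kato's pinned `𝐇¹` satisfies `s ∉ p^{n+1}𝐇¹` (Euler loss
`δ(s) ≤ n`), then `μ(p^n · X₀) = 0` for every dual fine Selmer datum `X₀ = Y.X` over `ℚ_∞` — every
elementary divisor `Λ/p^{μ_i}` of `X₀` has `μ_i ≤ n`.  Verbatim the audited `HOME/es/Sketch4.lean`.
[cite: Kato2004Asterisque, Thm. 13.4 (p. 226) and §13.8 — the bound at `𝔭 ∌ p`; OPEN at `𝔭 = (p)` on X9]
[cite: MazurRubin2004, Thm. 5.3.10 and p. 67 («repeat the argument with `𝔓_N = (U^N + p)`», with `τ`)] -/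
@[conjecture] def FineExponentLeEulerLossOnClassX9 : Prop :=
  ∀ (W : WeierstrassCurve ℚ) [W.IsElliptic] [W.IsGloballyMinimal] (p : ℕ) [Fact p.Prime]
    [ContinuousSMul ℤ_[p] (W.tateModule p)] [Module.Free ℤ_[p] (W.tateModule p)]
    [Module.Finite ℤ_[p] (W.tateModule p)]
    (κ : ZpExtension ℚ p) (γ : absoluteGaloisGroup ℚ) (I : IwasawaH1Data W p κ γ) (n : ℕ),
    ClassX9 W p → κ.IsCyclotomic → κ.IsTopGenerator γ → IsCyclotomicVariable p γ →
    (∃ s : I.H, IsEulerSystemClass W p κ γ I s ∧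
      s ∉ (IwasawaAlgebra.augIdealP p ^ (n + 1)) • (⊤ : Submodule (IwasawaAlgebra p) I.H)) →
    ∀ Y : W.FineSelmerDualData κ γ,
      muInvariant p ↥((IwasawaAlgebra.augIdealP p ^ n) • (⊤ : Submodule (IwasawaAlgebra p) Y.X)) = 0

/-- **B2 — at most one `μ`-elementary divisor of `X₀(E/ℚ_∞)` on class X9 (OPEN; STRICTLY WEAKER than
Conjecture A on X9; nothing asserted).**  For a finitely generated torsion `Λ`-module
`M ∼ ⊕ Λ/p^{μ_i} ⊕ …` one has `μ(p^n M) = Σ max(μ_i − n, 0)`, so «`∀ n, μ(p^n M) = 0 → μ(M) ≤ n`» says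
`Σ μ_i ≤ max μ_i`, i.e. the WIDTH is `≤ 1`.  It is the conclusion of the cell's KOLY Thm 5.6.3
(`p ∤ f ⟹ rank_Ω 𝐇²/p ≤ 1`) with the hypothesis `p ∤ f` (Euler loss `0`) removed.  With ES-C4 it gives
S-es-3 (edges file).  Verbatim `HOME/es/Sketch4.lean`.
[cite: Kato2004Asterisque, Thm. 12.5 and 12.6 (p. 222) — shape only; OPEN]
[cite: CoatesSujatha2005, Conjecture A (§3) — which implies it (width 0)] -/
@[conjecture] def FineMuConcentratedOnClassX9 : Prop :=
  ∀ (W : WeierstrassCurve ℚ) [W.IsElliptic] [W.IsGloballyMinimal] (p : ℕ) [Fact p.Prime]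
    (κ : ZpExtension ℚ p) (γ : absoluteGaloisGroup ℚ),
    ClassX9 W p → κ.IsCyclotomic → κ.IsTopGenerator γ → IsCyclotomicVariable p γ →
    ∀ (Y : W.FineSelmerDualData κ γ) (n : ℕ),
      muInvariant p ↥((IwasawaAlgebra.augIdealP p ^ n) • (⊤ : Submodule (IwasawaAlgebra p) Y.X)) = 0 →
      muInvariant p Y.X ≤ n

/-- **ES-C5 — no `μ`-divisor of `X(E/ℚ_∞)` deeper than `μ(L_p)`, on class X9 (OPEN for `n ≥ 1`; graded;
nothing asserted).**  At every X9 pair, all cyclotomic data, every newform `f` and every `n : ℕ`: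
`μ(L_p(E)) ≤ n` (some coefficient of `L_p(f, α_p)` has norm `≥ p^{-n}`) implies `μ(p^n · X(E/ℚ_∞)) = 0`
for every dual Selmer datum — the whole `μ`-part of `X` is killed by `p^{μ(L_p)}` up to pseudo-nullity.
On paper: ES-C4 for Kato's class (`δ ≤ μ(L_p)` via the Coleman image, F1) + the extension
`0 → H¹_s/loc 𝐇¹ → X → X₀ → 0` (`μ`-exponents subadditive).  At `n = 0` it reads `μ(L_p) = 0 ⟹ μ(X) = 0`
= the tree's X9 `μ`-transfer (`KatoMuTransfer`, 19629, restricted to X9; decided TRUE on 790/790 census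
rows).  The planner's per-pair `MuExponentLeAnalyticMuAt` is INLINED here (ref1: file only the X9
version — the per-pair def lacks an ordinarity guard).  Verbatim the audited Sketch body.
[cite: Kato2004Asterisque, Thm. 17.4 (p. 273) and §17.13 (pp. 279–280) — between 17.4 (2) and 17.4 (3); OPEN]
[cite: GreenbergVatsal2000, Prop. 3.7 (integrality of `L_p`)] -/
@[conjecture] def MuExponentLeAnalyticMuOnClassX9 : Prop :=
  ∀ (W : WeierstrassCurve ℚ) [W.IsElliptic] [W.IsGloballyMinimal] (p : ℕ) [Fact p.Prime],
    ClassX9 W p →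
    ∀ (κ : ZpExtension ℚ p) (γ : absoluteGaloisGroup ℚ) {N : ℕ} [NeZero N]
      (f : CuspForm (Gamma0 N) 2) (n : ℕ),
      κ.IsCyclotomic → κ.IsTopGenerator γ → IsCyclotomicVariable p γ → IsNewformOf W f →
      (∃ m : ℕ, (p : ℝ) ^ (-(n : ℤ)) ≤
        ‖PowerSeries.coeff m (padicLFunction f (unitRoot W p : ℚ_[p]))‖) →
      ∀ D : W.SelmerDualData κ γ,
        muInvariant p ↥((IwasawaAlgebra.augIdealP p ^ n) • (⊤ : Submodule (IwasawaAlgebra p) D.X)) = 0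

end Summit.BirchSwinnertonDyer.Rank1Residual.SmallImageMu

end
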